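import Mathlib
import Summits.Ventures.HodgeRepro.Tier4.Line1.RTFSetting
import Summits.Ventures.HodgeRepro.Tier4.Line1.LeftTypeOfMatrixCoeff

/-!
# Tier4/Line1/FiniteRankTypeApprox — finite-rank left-`K`-types form a star-algebra, and are uniformly DENSE
among the continuous functions on a compact open `X` that factor through finitely many "coordinates" of that type
(Stone–Weierstrass, no Peter–Weyl)

Blind re-derivation cell `pub-hodge-repro`, Tier 4 (README §9–§10), seat t4-L1-p4 (gen 4), LINE L1; generic over a
topological group `G`.  Target tree path `lean/Summits/Ventures/HodgeRepro/Tier4/Line1/FiniteRankTypeApprox.lean`.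
Imports p2's `LeftTypeOfMatrixCoeff` (`HasFiniteRankLeftType`, `.add`, `.const_mul`, `.of_left_invariant`).  0 print.

WHAT IS PROVED.
* closure of `IsTest` under sums / products / scalars (`IsTest.add`, `IsTest.mul`, `IsTest.const_mul`) and of
  `HasFiniteRankLeftType K` under products and complex conjugation (`HasFiniteRankLeftType.mul`, `.star`: the ranks
  multiply, `e (i,j) k = e i k * e' j k`, `c (i,j) = c i * c' j`); the characteristic function of a compact open set is
  a test function (`isTest_indicator_of_isCompact_isOpen`), of finite-rank left-`K`-type when the set is
  left-`K`-invariant (`hasFiniteRankLeftType_indicator_of_left_invariant`, rank `1`).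
* **`exists_finiteRankLeftType_approx`** — THE DENSITY STATEMENT: `X ⊆ G` compact open, `K` a subgroup with `1_X` of
  finite-rank left-`K`-type, `u i : G → ℂ` (`i` in a finite index set) continuous "coordinates" with `1_X · u i` of
  finite-rank left-`K`-type, and `f₀` continuous, vanishing off `X` and constant on the fibres of `g ↦ (u i g)_i` on
  `X`; then for every `η > 0` there is a test function `h`, vanishing off `X`, of finite-rank left-`K`-type, with
  `‖h − f₀‖_∞ ≤ η`.  Proof: `Y := Φ '' X ⊆ ℂ^ι` (`Φ g := (u i g)_i`) is compact; `f₀` descends to a continuous `F` on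
  `Y` (`Φ : X → Y` is a closed map between compact Hausdorff spaces, hence a quotient map); the star-subalgebra of
  `C(Y, ℂ)` generated by the coordinate functions separates the points of `Y ⊆ ℂ^ι` trivially, so Stone–Weierstrass
  (Mathlib `ContinuousMap.starSubalgebra_topologicalClosure_eq_top_of_separatesPoints`) gives a polynomial `P` in the
  coordinates and their conjugates with `‖P − F‖ < η` on `Y`; lifted back by `0` off the clopen `X`, every element of
  that star-subalgebra is a test function of finite-rank left-`K`-type (`StarSubalgebra.adjoin_induction` over the
  closure lemmas above), and `h := P ∘ Φ` on `X` is the approximant.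
For LINE L1 this is the archimedean half of the F2′ → (S1b) bridge WITHOUT Peter–Weyl: on the instance the
coordinates are the characteristic functions of the `K_f(N) × G_∞`-cosets of `X` and the archimedean matrix entries
`archMat W w g i j` (p2's ArchMatrixCoeff), the consumer file supplies the fibre condition.  Nothing here says anything
about the status of the Hodge conjecture for CM abelian varieties, which is NOT proved (HC_CM is NOT proved by anyone
in this repository).
-/

set_option autoImplicit false

noncomputable section

namespace Summit.Ventures.HodgeRepro.Tier4.Line1.RTF

open Topology

variable {G : Type} [Group G] [TopologicalSpace G]

section TestClosure

omit [Group G] in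
/-- the sum of two test functions is a test function. -/
theorem IsTest.add {f f' : G → ℂ} (hf : IsTest f) (hf' : IsTest f') : IsTest (fun g => f g + f' g) :=
  ⟨hf.cont.add hf'.cont, hf.compact.add hf'.compact⟩

omit [Group G] in
/-- the product of two test functions is a test function. -/
theorem IsTest.mul {f f' : G → ℂ} (hf : IsTest f) (hf' : IsTest f') : IsTest (fun g => f g * f' g) :=
  ⟨hf.cont.mul hf'.cont, hf.compact.mul_right⟩

omit [Group G] in
/-- a scalar multiple of a test function is a test function. -/
theorem IsTest.const_mul {f : G → ℂ} (hf : IsTest f) (a : ℂ) : IsTest (fun g => a * f g) :=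
  ⟨continuous_const.mul hf.cont, hf.compact.mul_left⟩

omit [Group G] in
/-- the complex conjugate of a test function is a test function (`IsTest.cj` unfolded). -/
theorem IsTest.star {f : G → ℂ} (hf : IsTest f) : IsTest (fun g => starRingEnd ℂ (f g)) :=
  hf.cj

omit [Group G] in
/-- **the characteristic function of a compact open set is a test function** (in a Hausdorff space the set is clopen,
so the indicator is continuous; the support lies in the compact set). -/
theorem isTest_indicator_of_isCompact_isOpen [T2Space G] {X : Set G} (hXc : IsCompact X) (hXo : IsOpen X) (a : ℂ) :
    IsTest (X.indicator fun _ => a) := by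
  have hcl : IsClosed X := hXc.isClosed
  refine ⟨?_, ?_⟩
  · exact IsClopen.continuous_indicator ⟨hcl, hXo⟩ continuous_const
  · exact HasCompactSupport.intro' hXc hcl fun x hx => Set.indicator_of_notMem hx _

end TestClosure

section RankClosure

variable {K : Subgroup G}

/-- **finite-rank left-`K`-types are closed under products** (the ranks multiply: `e (i, j) k = e i k * e' j k`,
`c (i, j) = c i * c' j`, the pairs indexed through `finProdFinEquiv`). -/
theorem HasFiniteRankLeftType.mul {f f' : G → ℂ} (hf : HasFiniteRankLeftType K f)
    (hf' : HasFiniteRankLeftType K f') : HasFiniteRankLeftType K (fun g => f g * f' g) := by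
  obtain ⟨r, e, c, hc, hdec⟩ := hf
  obtain ⟨r', e', c', hc', hdec'⟩ := hf'
  refine ⟨r * r', fun p k => e (finProdFinEquiv.symm p).1 k * e' (finProdFinEquiv.symm p).2 k,
    fun p g => c (finProdFinEquiv.symm p).1 g * c' (finProdFinEquiv.symm p).2 g,
    fun p => (hc _).mul (hc' _), fun k g => ?_⟩
  simp only
  rw [hdec k g, hdec' k g, Fintype.sum_mul_sum,
    Equiv.sum_comp finProdFinEquiv.symm
      (fun q : Fin r × Fin r' => e q.1 k * e' q.2 k * (c q.1 g * c' q.2 g)), Fintype.sum_prod_type]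
  exact Finset.sum_congr rfl fun i _ => Finset.sum_congr rfl fun j _ => by ring

/-- **finite-rank left-`K`-types are closed under complex conjugation** (conjugate the coefficients and the test
functions of the decomposition). -/
theorem HasFiniteRankLeftType.star {f : G → ℂ} (hf : HasFiniteRankLeftType K f) :
    HasFiniteRankLeftType K (fun g => starRingEnd ℂ (f g)) := by
  obtain ⟨r, e, c, hc, hdec⟩ := hf
  refine ⟨r, fun i k => starRingEnd ℂ (e i k), fun i g => starRingEnd ℂ (c i g), fun i => (hc i).star,
    fun k g => ?_⟩
  simp only [hdec k g, map_sum, map_mul]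

/-- the characteristic function of a compact open left-`K`-invariant set has a finite-rank left-`K`-type (rank `1`). -/
theorem hasFiniteRankLeftType_indicator_of_left_invariant [T2Space G] {X : Set G} (hXc : IsCompact X)
    (hXo : IsOpen X) (hKX : ∀ k ∈ K, ∀ g, k * g ∈ X ↔ g ∈ X) (a : ℂ) :
    HasFiniteRankLeftType K (X.indicator fun _ => a) := by
  refine HasFiniteRankLeftType.of_left_invariant (isTest_indicator_of_isCompact_isOpen hXc hXo a) ?_
  intro k hk g
  by_cases hg : g ∈ X
  · rw [Set.indicator_of_mem ((hKX k hk g).2 hg), Set.indicator_of_mem hg]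
  · rw [Set.indicator_of_notMem (fun h => hg ((hKX k hk g).1 h)), Set.indicator_of_notMem hg]

end RankClosure

section Density

variable [T2Space G] {K : Subgroup G}

/-- **DENSITY OF FINITE-RANK LEFT-`K`-TYPES (Stone–Weierstrass)**: `X` compact open with `1_X` of finite-rank
left-`K`-type, continuous coordinates `u i` with `1_X · u i` of finite-rank left-`K`-type, and `f₀` continuous,
vanishing off `X` and constant on the fibres of `g ↦ (u i g)_i` over `X`.  Then for every `η > 0` there is a test
function `h`, vanishing off `X`, of finite-rank left-`K`-type, with `‖h − f₀‖_∞ ≤ η` (a polynomial in the coordinates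
and their conjugates, cut off to `X`). -/
theorem exists_finiteRankLeftType_approx {X : Set G} (hXc : IsCompact X) (hXo : IsOpen X)
    (hX1 : HasFiniteRankLeftType K (X.indicator fun _ => (1 : ℂ)))
    {ι : Type} [Fintype ι] (u : ι → G → ℂ) (hu : ∀ i, Continuous (u i))
    (hut : ∀ i, HasFiniteRankLeftType K (X.indicator (u i)))
    {f₀ : G → ℂ} (h₀ : Continuous f₀) (hf₀ : ∀ g, g ∉ X → f₀ g = 0)
    (hfib : ∀ x ∈ X, ∀ y ∈ X, (∀ i, u i x = u i y) → f₀ x = f₀ y) {η : ℝ} (hη : 0 < η) :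
    ∃ h : G → ℂ, IsTest h ∧ (∀ g, g ∉ X → h g = 0) ∧ HasFiniteRankLeftType K h ∧
      ∀ g, ‖h g - f₀ g‖ ≤ η := by
  classical
  have hXcl : IsClosed X := hXc.isClosed
  -- the coordinate map and its compact image
  let Φ : G → (ι → ℂ) := fun g i => u i g
  have hΦ : Continuous Φ := continuous_pi hu
  let Y : Set (ι → ℂ) := Φ '' X
  haveI : CompactSpace Y := isCompact_iff_compactSpace.mp (hXc.image hΦ)
  haveI : CompactSpace X := isCompact_iff_compactSpace.mp hXc
  let q : X → Y := fun x => ⟨Φ x, ⟨x, x.2, rfl⟩⟩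
  have hq : Continuous q := (hΦ.comp continuous_subtype_val).subtype_mk _
  have hqs : Function.Surjective q := by
    rintro ⟨y, x, hx, rfl⟩
    exact ⟨⟨x, hx⟩, rfl⟩
  have hqq : IsQuotientMap q := hq.isClosedMap.isQuotientMap hq hqs
  -- `f₀` descends to `Y`
  let F : Y → ℂ := fun y => f₀ (Classical.choose y.2)
  have hF : ∀ x (hx : x ∈ X), F ⟨Φ x, ⟨x, hx, rfl⟩⟩ = f₀ x := by
    intro x hx
    obtain ⟨hx', hΦx⟩ := Classical.choose_spec (⟨x, hx, rfl⟩ : ∃ x', x' ∈ X ∧ Φ x' = Φ x)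
    exact hfib _ hx' x hx fun i => congrFun hΦx i
  have hFc : Continuous F := by
    rw [hqq.continuous_iff]
    have : F ∘ q = fun x : X => f₀ x := by
      funext x
      exact hF x x.2
    rw [this]
    exact h₀.comp continuous_subtype_val
  let Fc : C(Y, ℂ) := ⟨F, hFc⟩
  -- the coordinate functions generate a point-separating star-subalgebra of `C(Y, ℂ)`
  let coord : ι → C(Y, ℂ) := fun i => ⟨fun y => y.1 i, (continuous_apply i).comp continuous_subtype_val⟩
  let A : StarSubalgebra ℂ C(Y, ℂ) := StarAlgebra.adjoin ℂ (Set.range coord)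
  have hsep : A.SeparatesPoints := by
    intro y y' hne
    have : ∃ i, y.1 i ≠ y'.1 i := by
      by_contra hcon
      apply hne
      apply Subtype.ext
      funext i
      by_contra hi
      exact hcon ⟨i, hi⟩
    obtain ⟨i, hi⟩ := this
    exact ⟨coord i, ⟨coord i, StarAlgebra.subset_adjoin ℂ _ ⟨i, rfl⟩, rfl⟩, hi⟩
  have hdense : A.topologicalClosure = ⊤ :=
    ContinuousMap.starSubalgebra_topologicalClosure_eq_top_of_separatesPoints A hsep
  have hmem : Fc ∈ closure (A : Set C(Y, ℂ)) := by
    rw [← StarSubalgebra.topologicalClosure_coe, hdense]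
    exact Set.mem_univ _
  obtain ⟨P, hPA, hPd⟩ := Metric.mem_closure_iff.1 hmem η hη
  -- the lift of a function on `Y` to `G`, by `0` off `X`
  let L : C(Y, ℂ) → G → ℂ := fun Q g => if hg : g ∈ X then Q ⟨Φ g, ⟨g, hg, rfl⟩⟩ else 0
  have hL0 : ∀ Q g, g ∉ X → L Q g = 0 := fun Q g hg => dif_neg hg
  have hLmem : ∀ Q g (hg : g ∈ X), L Q g = Q ⟨Φ g, ⟨g, hg, rfl⟩⟩ := fun Q g hg => dif_pos hg
  have hLc : ∀ Q : C(Y, ℂ), Continuous (L Q) := by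
    intro Q
    rw [continuous_iff_continuousAt]
    intro g
    by_cases hg : g ∈ X
    · have hcont : ContinuousOn (L Q) X := by
        rw [continuousOn_iff_continuous_restrict]
        have : X.restrict (L Q) = fun x : X => Q (q x) := by
          funext x
          exact hLmem Q x x.2
        rw [this]
        exact Q.continuous.comp hq
      exact hcont.continuousAt (hXo.mem_nhds hg)
    · have hcont : ContinuousOn (L Q) Xᶜ :=
        (continuousOn_const (c := (0 : ℂ))).congr fun x hx => hL0 Q x hx
      exact hcont.continuousAt (hXcl.isOpen_compl.mem_nhds hg)
  have hLt : ∀ Q, IsTest (L Q) := fun Q =>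
    ⟨hLc Q, HasCompactSupport.intro' hXc hXcl fun g hg => hL0 Q g hg⟩
  have hLadd : ∀ Q Q', L (Q + Q') = fun g => L Q g + L Q' g := by
    intro Q Q'
    funext g
    by_cases hg : g ∈ X
    · simp only [L, dif_pos hg, ContinuousMap.add_apply]
    · simp only [L, dif_neg hg, add_zero]
  have hLmul : ∀ Q Q', L (Q * Q') = fun g => L Q g * L Q' g := by
    intro Q Q'
    funext g
    by_cases hg : g ∈ X
    · simp only [L, dif_pos hg, ContinuousMap.mul_apply]
    · simp only [L, dif_neg hg, mul_zero]
  have hLstar : ∀ Q, L (star Q) = fun g => starRingEnd ℂ (L Q g) := by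
    intro Q
    funext g
    by_cases hg : g ∈ X
    · simp only [L, dif_pos hg, ContinuousMap.star_apply, Complex.star_def]
    · simp only [L, dif_neg hg, map_zero]
  have hLalg : ∀ r : ℂ, L (algebraMap ℂ C(Y, ℂ) r) = fun g => r * X.indicator (fun _ => (1 : ℂ)) g := by
    intro r
    funext g
    by_cases hg : g ∈ X
    · simp only [L, dif_pos hg, Set.indicator_of_mem hg, mul_one, Algebra.algebraMap_eq_smul_one,
        ContinuousMap.smul_apply, ContinuousMap.one_apply, smul_eq_mul]
    · simp only [L, dif_neg hg, Set.indicator_of_notMem hg, mul_zero]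
  have hLcoord : ∀ i, L (coord i) = X.indicator (u i) := by
    intro i
    funext g
    by_cases hg : g ∈ X
    · simp only [L, dif_pos hg, Set.indicator_of_mem hg, coord, ContinuousMap.coe_mk, Φ]
    · simp only [L, dif_neg hg, Set.indicator_of_notMem hg]
  -- every element of the star-subalgebra lifts to a finite-rank left-`K`-type
  have hA : ∀ Q ∈ A, HasFiniteRankLeftType K (L Q) := by
    intro Q hQ
    refine StarAlgebra.adjoin_induction (p := fun Q _ => HasFiniteRankLeftType K (L Q)) ?_ ?_ ?_ ?_ ?_ hQ
    · rintro x ⟨i, rfl⟩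
      rw [hLcoord]
      exact hut i
    · intro r
      rw [hLalg]
      exact hX1.const_mul r
    · intro x y _ _ hx hy
      rw [hLadd]
      exact hx.add hy
    · intro x y _ _ hx hy
      rw [hLmul]
      exact hx.mul hy
    · intro x _ hx
      rw [hLstar]
      exact hx.star
  -- the approximant
  refine ⟨L P, hLt P, hL0 P, hA P hPA, fun g => ?_⟩
  by_cases hg : g ∈ X
  · rw [hLmem P g hg, ← hF g hg]
    have h1 : dist (P ⟨Φ g, ⟨g, hg, rfl⟩⟩) (Fc ⟨Φ g, ⟨g, hg, rfl⟩⟩) ≤ dist P Fc :=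
      ContinuousMap.dist_apply_le_dist _
    rw [dist_eq_norm] at h1
    have h2 : dist P Fc < η := by
      rw [dist_comm]
      exact hPd
    exact h1.trans h2.le
  · rw [hL0 P g hg, hf₀ g hg, sub_zero, norm_zero]
    exact hη.le

end Density

end Summit.Ventures.HodgeRepro.Tier4.Line1.RTF

end
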